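import Mathlib
import HarnessLib

/-!
# Rayleigh set systems in probability normalisation — definitions (first-slot classification for the one-step scheme)

Definitions file (prover prim-ineq-prove-3 gen 34; `--supports stmt-CriticalPhenomena-4575`; memo
`run/shared/lean/prim/prim-ineq-prove-3/FINDING-G33-KERNEL-FORMS.md` §7 and `FINDING-G34-*.md`).  Consumed by
`…SahiOneStepRayleighMatroidMinor`, `…SahiOneStepRayleighMatroid` (Rayleigh + down-closed [Mathlib `IsLowerSet`] ⟹ matroid complex) and
`…SahiOneStepMatroidSlot` (necessity of the matroid structure for the `(2′)` first slot of the one-step scheme).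

Setting: a finite ground type `ι`, density vectors `p : ι → ℝ` (used on the closed cube `[0,1]^ι`), families of finite sets
`𝓛 : Finset (Finset ι)`.
* `rwt p S = ∏_i (p_i if i ∈ S else 1 − p_i)` — the product-Bernoulli weight of `S`; `rmass p 𝓐 = Σ_{S ∈ 𝓐} rwt p S`.
* `IsRayleighFamily 𝓛` — for all `p ∈ [0,1]^ι` and `e ≠ f`: `μ_p(𝓛∩[e]∩[f])·μ_p(𝓛) ≤ μ_p(𝓛∩[e])·μ_p(𝓛∩[f])`
  (pairwise non-positive correlation of the coordinates under the product measure conditioned on `𝓛`; on the open cube this is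
  Wagner's Rayleigh condition `Z_e Z_f ≥ Z_{ef} Z` for `Z = Σ_{S∈𝓛} y^S`, `y = p/(1−p)`).
* `fminor A D 𝓛` — the minor contract-`A`/delete-`D` inside the same ground type;
  `pin p A D` — the density vector pinned to `1` on `A` and `0` on `D`; `rrest` — the free part of a weight;
  `slotComplex H` — the finite sets not in an event `H ⊆ Set ι` (for an up-set `H`, the candidate independence complex).
No named facts, no sorries.
-/

noncomputable section

namespace Summit.CriticalPhenomena.PercolationContinuityZ3.Theorems

namespace SahiOneStep

open Finset

variable {ι : Type*} [Fintype ι] [DecidableEq ι]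

/-! ## Definitions -/

/-- The product-Bernoulli weight of a finite set `S` for the density vector `p`:
`w_p(S) = ∏_{i ∈ S} p_i · ∏_{i ∉ S} (1 − p_i)`. [folklore] -/
def rwt (p : ι → ℝ) (S : Finset ι) : ℝ := ∏ i, (if i ∈ S then p i else 1 - p i)

/-- The mass `μ_p(𝓐) = Σ_{S ∈ 𝓐} w_p(S)` of a family of finite sets. [folklore] -/
def rmass (p : ι → ℝ) (𝓐 : Finset (Finset ι)) : ℝ := ∑ S ∈ 𝓐, rwt p S

/-- A family `𝓛` is **Rayleigh (probability normalisation, closed cube)**: for every density vector `p ∈ [0,1]^ι` and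
all `e ≠ f`, `μ_p(𝓛 ∩ [e] ∩ [f])·μ_p(𝓛) ≤ μ_p(𝓛 ∩ [e])·μ_p(𝓛 ∩ [f])` (`[e]` = the sets containing `e`), i.e. the coordinates
`e, f` are non-positively correlated under the product measure conditioned on `𝓛`.  For `p` in the open cube this is Wagner's
Rayleigh condition `Z_e Z_f ≥ Z_{ef} Z` for `Z = Σ_{S ∈ 𝓛} y^S` at the field `y = p/(1−p)`.
(Wagner 2008 §3; Semple–Welsh 2008 §2, "independence-correlated" for matroid complexes). [this work] -/
def IsRayleighFamily (𝓛 : Finset (Finset ι)) : Prop :=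
  ∀ p : ι → ℝ, (∀ i, 0 ≤ p i) → (∀ i, p i ≤ 1) → ∀ e f : ι, e ≠ f →
    rmass p (𝓛.filter fun S => e ∈ S ∧ f ∈ S) * rmass p 𝓛 ≤
      rmass p (𝓛.filter fun S => e ∈ S) * rmass p (𝓛.filter fun S => f ∈ S)

/-- The pinned density vector: `1` on `A`, `0` on `D`, `p` elsewhere. [this work] -/
def pin (p : ι → ℝ) (A D : Finset ι) : ι → ℝ := fun i => if i ∈ A then 1 else if i ∈ D then 0 else p i

/-- The minor `𝓛 / A ∖ D` (contract `A`, delete `D`) as a family of subsets of the same ground type avoiding `A ∪ D`: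
`{S ∖ A : S ∈ 𝓛, A ⊆ S, D ∩ S = ∅}`. [folklore] -/
def fminor (A D : Finset ι) (𝓛 : Finset (Finset ι)) : Finset (Finset ι) :=
  (𝓛.filter fun S => A ⊆ S ∧ Disjoint D S).image fun S => S \ A


/-- The "free part" of the weight: the factors off `A ∪ D` (auxiliary for the minor identities). [this work] -/
def rrest (p : ι → ℝ) (A D S : Finset ι) : ℝ := ∏ i ∈ univ \ (A ∪ D), (if i ∈ S then p i else 1 - p i)

open scoped Classical in
/-- The family of finite sets NOT in the (increasing) event `H`: the candidate independence complex. [this work] -/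
def slotComplex (H : Set (Set ι)) : Finset (Finset ι) :=
  Finset.univ.filter fun S : Finset ι => (↑S : Set ι) ∉ H

end SahiOneStep

end Summit.CriticalPhenomena.PercolationContinuityZ3.Theorems
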